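import Literature.NumberTheory.Automorphic.WhittakerTorusJacquetGL2
import Literature.NumberTheory.Automorphic.RankinSelbergLocalLFactor
import HarnessLib

/-!
# The `GL_n × GL₁` Rankin–Selberg `L`-factor does not depend on the invariant measure

Topic `Literature/NumberTheory/Automorphic`; proof file (theorems only: no definition, no named
fact, no instance).  The predicate `HasRSLFactor hmn π π' ψ ν P` ("`L(s, π × π') = 1/P(q^{-s})`
in the sense of Jacquet–Piatetski-Shapiro–Shalika 1983, Thm. 2.7 (i)–(ii)") of `RankinSelbergLocal`
carries the measure `ν` on `GL_m(F) ⧸ U_m` as a PARAMETER (intended: the `GL_m(F)`-invariant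
one).  For `m = 1` (`U₁ = 1`, `GL₁(F) ⧸ U₁ = Fˣ`) we prove that the predicate is the same for
all invariant Radon measures of full support, as it must be (JPSS loc. cit.: the fractional ideal
spanned by the `Ψ(s; W, W')` is unchanged when all integrals are multiplied by a positive
constant):

* `exists_isHaarMeasure_integral_eq` — every `GL₁(F)`-invariant Borel measure `ν` on
  `GL₁(F) ⧸ U₁`, finite on compacts and positive on opens, is the transport of a Haar measure
  `μ'` of `Fˣ` along `a ↦ [diag(a)]`: `∫ f dν = ∫_{Fˣ} f([diag a]) dμ'(a)` (converse of
  `exists_haar_measure_quotient_fin_one`).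
* `exists_pos_integral_eq_mul` — two such measures have proportional integrals,
  `∫ f dν₂ = c · ∫ f dν₁` with `c > 0` (uniqueness of Haar measure on the second-countable
  locally compact group `Fˣ`, Mathlib `Measure.isMulLeftInvariant_eq_smul`).
* `HasRSLFactor.of_integral_eq_mul` — if `∫ f dν₂ = c ∫ f dν₁` (`c ≠ 0`) then
  `HasRSLFactor hmn π π' ψ ν₁ P → HasRSLFactor hmn π π' ψ ν₂ P` (every `GL_n × GL₁` zeta
  integral is multiplied by `c`; Laurent numerators and the combination of clause (b) are
  rescaled).
* `hasRSLFactor_iff_of_smulInvariant` — **measure independence**: for invariant Radon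
  full-support `ν₁`, `ν₂` on `GL₁(F) ⧸ U₁` and every `n > 1`, `π`, `π'`, `ψ`, `P`,
  `HasRSLFactor hn π π' ψ ν₁ P ↔ HasRSLFactor hn π π' ψ ν₂ P`.
* `natDegree_le_finrank_of_hasRSLFactor'` — consequently the pole bound
  `natDegree_le_finrank_of_hasRSLFactor` of `WhittakerTorusJacquetGL2` (Jacquet–Langlands 1970,
  Props. 2.9–2.10 / 3.5) holds for EVERY invariant Radon full-support `ν`, not only for the
  transported Haar measure it produces.

## References

* H. Jacquet, I. I. Piatetski-Shapiro, J. Shalika, *Rankin–Selberg convolutions*, Amer. J. Math.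
  105 (1983), §2.4, Thm. 2.7 (i)–(ii). [JacquetPiatetskiShapiroShalika1983]
* J. W. Cogdell, *Analytic theory of `L`-functions for `GL_n`* (2004), §6.1, Thm. 6.2.
  [CogdellAnalyticTheory2004]
* H. Jacquet, R. P. Langlands, *Automorphic forms on GL(2)*, LNM 114 (1970), Props. 2.9–2.10,
  Prop. 3.5. [JacquetLanglands1970]
-/

noncomputable section

open scoped MatrixGroups NNReal ENNReal
open MeasureTheory ValuativeRel Polynomial Filter
  Literature.NumberTheory.GaloisRepresentations.IsNonarchimedeanLocalField
  Literature.NumberTheory.EllipticCurves.Hida2000Thm326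

namespace Literature.NumberTheory.Automorphic

/-! ### Part 1: invariant measures on `GL₁(F) ⧸ U₁` are transported Haar measures of `Fˣ` -/

section Transport

variable {F : Type*} [Field F] [ValuativeRel F] [TopologicalSpace F] [IsNonarchimedeanLocalField F]
  [MeasurableSpace F] [BorelSpace F]
  [MeasurableSpace (GL (Fin 1) F ⧸ upperUnitriangular (Fin 1) F)]
  [BorelSpace (GL (Fin 1) F ⧸ upperUnitriangular (Fin 1) F)]

omit [MeasurableSpace F] [BorelSpace F] [MeasurableSpace (GL (Fin 1) F ⧸ upperUnitriangular (Fin 1) F)]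
  [BorelSpace (GL (Fin 1) F ⧸ upperUnitriangular (Fin 1) F)] in
/-- **The homeomorphism `Fˣ ≃ₜ GL₁(F) ⧸ U₁`, `a ↦ [diag(a)]`**, with inverse induced by `det` and
the equivariance `[diag(det c · a)] = c • [diag(a)]`. [folklore] -/
theorem exists_homeomorph_units_quotient_fin_one :
    ∃ e : Fˣ ≃ₜ GL (Fin 1) F ⧸ upperUnitriangular (Fin 1) F,
      (∀ a : Fˣ, e a = QuotientGroup.mk (glDiagonal 1 F fun _ => a)) ∧
      ∀ (c : GL (Fin 1) F) (a : Fˣ), e (Matrix.GeneralLinearGroup.det c * a) = c • e a := by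
  -- the embedding `d : Fˣ →* GL₁(F)`
  set d : Fˣ →* GL (Fin 1) F :=
    (glDiagonal 1 F).comp ⟨⟨fun a _ => a, rfl⟩, fun _ _ => rfl⟩ with hd
  have hd_apply : ∀ a, d a = glDiagonal 1 F (fun _ => a) := fun a => rfl
  have hdet : ∀ a, Matrix.GeneralLinearGroup.det (d a) = a := fun a => by
    rw [hd_apply, det_glDiagonal_fin_one]
  have hd_det : ∀ g : GL (Fin 1) F, d (Matrix.GeneralLinearGroup.det g) = g := fun g => by
    rw [hd_apply, glDiagonal_det_eq]
  have hdc : Continuous d := by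
    refine Units.continuous_iff.2 ⟨?_, ?_⟩
    · show Continuous fun a : Fˣ => ((d a : GL (Fin 1) F) : Matrix (Fin 1) (Fin 1) F)
      have : (fun a : Fˣ => ((d a : GL (Fin 1) F) : Matrix (Fin 1) (Fin 1) F)) =
          fun a : Fˣ => Matrix.diagonal fun _ : Fin 1 => (a : F) :=
        funext fun a => by rw [hd_apply, coe_glDiagonal]
      rw [this]
      exact (continuous_pi fun _ => Units.continuous_val).matrix_diagonal
    · show Continuous fun a : Fˣ => ((↑(d a)⁻¹ : Matrix (Fin 1) (Fin 1) F))
      have : (fun a : Fˣ => ((↑(d a)⁻¹ : Matrix (Fin 1) (Fin 1) F))) =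
          fun a : Fˣ => Matrix.diagonal fun _ : Fin 1 => ((a⁻¹ : Fˣ) : F) := funext fun a => by
        rw [← map_inv, hd_apply, coe_glDiagonal]
      rw [this]
      exact (continuous_pi fun _ => Units.continuous_coe_inv).matrix_diagonal
  have hdetc : Continuous (Matrix.GeneralLinearGroup.det : GL (Fin 1) F → Fˣ) := by
    refine Units.continuous_iff.2 ⟨?_, ?_⟩
    · show Continuous fun g : GL (Fin 1) F => ((Matrix.GeneralLinearGroup.det g : Fˣ) : F)
      exact (continuous_id.matrix_det).comp Units.continuous_val
    · show Continuous fun g : GL (Fin 1) F => ((↑(Matrix.GeneralLinearGroup.det g)⁻¹ : F))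
      have : (fun g : GL (Fin 1) F => ((↑(Matrix.GeneralLinearGroup.det g)⁻¹ : F))) =
          fun g : GL (Fin 1) F => ((↑(g⁻¹) : Matrix (Fin 1) (Fin 1) F)).det := funext fun g => by
        rw [← map_inv, Matrix.GeneralLinearGroup.val_det_apply]
      rw [this]
      exact (continuous_id.matrix_det).comp Units.continuous_coe_inv
  have hcompat : ∀ a b : GL (Fin 1) F, QuotientGroup.leftRel (upperUnitriangular (Fin 1) F) a b →
      Matrix.GeneralLinearGroup.det a = Matrix.GeneralLinearGroup.det b := by
    intro a b hab
    rw [QuotientGroup.leftRel_apply] at hab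
    have h1 : a⁻¹ * b = 1 := upperUnitriangular_fin_one_coe_eq_one ⟨a⁻¹ * b, hab⟩
    rw [inv_mul_eq_one] at h1
    rw [h1]
  set einv : GL (Fin 1) F ⧸ upperUnitriangular (Fin 1) F → Fˣ :=
    Quotient.lift (Matrix.GeneralLinearGroup.det) hcompat with heinv
  have heinv_mk : ∀ g : GL (Fin 1) F,
      einv (QuotientGroup.mk g) = Matrix.GeneralLinearGroup.det g := fun g => rfl
  refine ⟨{ toFun := fun a => QuotientGroup.mk (d a)
            invFun := einv
            left_inv := fun a => by
              change einv (QuotientGroup.mk (d a)) = a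
              rw [heinv_mk, hdet]
            right_inv := fun x => by
              induction x using QuotientGroup.induction_on with
              | H g =>
                change (QuotientGroup.mk (d (einv (QuotientGroup.mk g))) :
                  GL (Fin 1) F ⧸ upperUnitriangular (Fin 1) F) = QuotientGroup.mk g
                rw [heinv_mk, hd_det]
            continuous_toFun := QuotientGroup.continuous_mk.comp hdc
            continuous_invFun := continuous_quot_lift _ hdetc }, fun a => rfl, fun c a => ?_⟩
  change (QuotientGroup.mk (d (Matrix.GeneralLinearGroup.det c * a)) :
      GL (Fin 1) F ⧸ upperUnitriangular (Fin 1) F) = c • QuotientGroup.mk (d a)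
  rw [map_mul, hd_det]
  rfl

/-- **Every invariant measure on `GL₁(F) ⧸ U₁` is a transported Haar measure of `Fˣ`.**  For a
`GL₁(F)`-invariant Borel measure `ν` on `GL₁(F) ⧸ U₁`, finite on compacts and positive on opens,
there is a Haar measure `μ'` on `Fˣ` with `∫ f dν = ∫_{Fˣ} f([diag a]) dμ'(a)` for every `f`
(namely the pull-back of `ν` along the homeomorphism `a ↦ [diag(a)]`: it is left invariant by
the equivariance `[diag(t a)] = diag(t) • [diag(a)]`). Converse of
`exists_haar_measure_quotient_fin_one`. [folklore] -/
theorem exists_isHaarMeasure_integral_eq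
    (ν : Measure (GL (Fin 1) F ⧸ upperUnitriangular (Fin 1) F))
    [SMulInvariantMeasure (GL (Fin 1) F) (GL (Fin 1) F ⧸ upperUnitriangular (Fin 1) F) ν]
    [IsFiniteMeasureOnCompacts ν] [ν.IsOpenPosMeasure] :
    ∃ (μ' : Measure Fˣ), μ'.IsHaarMeasure ∧
      ∀ f : GL (Fin 1) F ⧸ upperUnitriangular (Fin 1) F → ℂ,
        ∫ x, f x ∂ν = ∫ a : Fˣ, f (QuotientGroup.mk (glDiagonal 1 F fun _ => a)) ∂μ' := by
  haveI : T2Space F :=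
    (Literature.NumberTheory.GaloisRepresentations.IsNonarchimedeanLocalField.isLocalField F).toT2Space
  haveI : BorelSpace Fˣ := Units.borelSpace
  obtain ⟨e, he, hemul⟩ := exists_homeomorph_units_quotient_fin_one (F := F)
  set em : Fˣ ≃ᵐ GL (Fin 1) F ⧸ upperUnitriangular (Fin 1) F := e.toMeasurableEquiv with hem
  have hem_apply : ∀ a, em a = e a := fun a => rfl
  set μ' : Measure Fˣ := Measure.map em.symm ν with hμ'
  have hμ'_apply : ∀ s : Set Fˣ, μ' s = ν (em.symm ⁻¹' s) := fun s => em.symm.map_apply s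
  have hmap : Measure.map em μ' = ν := by rw [hμ', em.map_map_symm]
  -- `d : Fˣ →* GL₁(F)` with `det (d t) = t`, to express `t * a = det (d t) * a`
  have hdiag : ∀ t : Fˣ, Matrix.GeneralLinearGroup.det (glDiagonal 1 F fun _ => t) = t :=
    fun t => det_glDiagonal_fin_one t
  -- left invariance of `μ'`
  have hinv : μ'.IsMulLeftInvariant := by
    refine ⟨fun t => ?_⟩
    refine Measure.ext fun s hs => ?_
    rw [Measure.map_apply (measurable_const_mul t) hs, hμ'_apply, hμ'_apply]
    have hset : em.symm ⁻¹' ((fun x => t * x) ⁻¹' s) =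
        (fun x => (glDiagonal 1 F fun _ => t) • x) ⁻¹' (em.symm ⁻¹' s) := by
      ext x
      obtain ⟨a, rfl⟩ : ∃ a, x = em a := ⟨em.symm x, (em.apply_symm_apply x).symm⟩
      simp only [Set.mem_preimage]
      rw [em.symm_apply_apply, hem_apply, ← hemul, hdiag, ← hem_apply, em.symm_apply_apply]
    rw [hset, measure_preimage_smul]
  have hfin : IsFiniteMeasureOnCompacts μ' := by
    refine ⟨fun K hK => ?_⟩
    rw [hμ'_apply, show em.symm ⁻¹' K = e '' K from ?_]
    · exact (hK.image e.continuous).measure_lt_top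
    · ext x
      simp only [Set.mem_preimage, Set.mem_image]
      constructor
      · intro hx
        exact ⟨em.symm x, hx, by rw [← hem_apply, em.apply_symm_apply]⟩
      · rintro ⟨a, ha, rfl⟩
        rwa [← hem_apply, em.symm_apply_apply]
  have hpos : μ'.IsOpenPosMeasure := by
    refine ⟨fun U hU hne => ?_⟩
    rw [hμ'_apply, show em.symm ⁻¹' U = e '' U from ?_]
    · exact (e.isOpenMap U hU).measure_ne_zero ν (hne.image e)
    · ext x
      simp only [Set.mem_preimage, Set.mem_image]
      constructor
      · intro hx
        exact ⟨em.symm x, hx, by rw [← hem_apply, em.apply_symm_apply]⟩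
      · rintro ⟨a, ha, rfl⟩
        rwa [← hem_apply, em.symm_apply_apply]
  haveI := hinv
  haveI := hfin
  haveI := hpos
  refine ⟨μ', ⟨⟩, fun f => ?_⟩
  rw [← hmap, em.measurableEmbedding.integral_map]
  simp_rw [hem_apply, he]

/-- **Two invariant measures on `GL₁(F) ⧸ U₁` have proportional integrals**: for `ν₁`, `ν₂`
both `GL₁(F)`-invariant, finite on compacts and positive on opens there is `c > 0` with
`∫ f dν₂ = c ∫ f dν₁` for every `f` (uniqueness of the Haar measure of the second-countable
locally compact group `Fˣ`, applied to the transports of `exists_isHaarMeasure_integral_eq`).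
[folklore] -/
theorem exists_pos_integral_eq_mul
    (ν₁ ν₂ : Measure (GL (Fin 1) F ⧸ upperUnitriangular (Fin 1) F))
    [SMulInvariantMeasure (GL (Fin 1) F) (GL (Fin 1) F ⧸ upperUnitriangular (Fin 1) F) ν₁]
    [IsFiniteMeasureOnCompacts ν₁] [ν₁.IsOpenPosMeasure]
    [SMulInvariantMeasure (GL (Fin 1) F) (GL (Fin 1) F ⧸ upperUnitriangular (Fin 1) F) ν₂]
    [IsFiniteMeasureOnCompacts ν₂] [ν₂.IsOpenPosMeasure] :
    ∃ c : ℝ, 0 < c ∧ ∀ f : GL (Fin 1) F ⧸ upperUnitriangular (Fin 1) F → ℂ,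
      ∫ x, f x ∂ν₂ = (c : ℂ) * ∫ x, f x ∂ν₁ := by
  haveI : T2Space F :=
    (Literature.NumberTheory.GaloisRepresentations.IsNonarchimedeanLocalField.isLocalField F).toT2Space
  haveI : BorelSpace Fˣ := Units.borelSpace
  haveI := secondCountableTopology_units F
  obtain ⟨μ₁, hμ₁, h₁⟩ := exists_isHaarMeasure_integral_eq ν₁
  obtain ⟨μ₂, hμ₂, h₂⟩ := exists_isHaarMeasure_integral_eq ν₂
  haveI := hμ₁
  haveI := hμ₂
  set κ : ℝ≥0 := μ₂.haarScalarFactor μ₁ with hκ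
  have hκpos : 0 < κ := Measure.haarScalarFactor_pos_of_isHaarMeasure μ₂ μ₁
  have hμ : μ₂ = κ • μ₁ := Measure.isMulLeftInvariant_eq_smul μ₂ μ₁
  refine ⟨κ, by exact_mod_cast hκpos, fun f => ?_⟩
  rw [h₂ f, h₁ f, hμ, integral_smul_nnreal_measure, NNReal.smul_def, Complex.real_smul]

end Transport

/-! ### Part 2: rescaling the measure does not change `HasRSLFactor` -/

section Rescale

variable {F : Type*} [Field F] [ValuativeRel F] [TopologicalSpace F] [IsNonarchimedeanLocalField F]
  {n m : ℕ} {V : Type*} [AddCommGroup V] [Module ℂ V] {V' : Type*} [AddCommGroup V'] [Module ℂ V']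
  [MeasurableSpace (GL (Fin m) F ⧸ upperUnitriangular (Fin m) F)]
  (hmn : m < n) (π : Representation ℂ (GL (Fin n) F) V) (π' : Representation ℂ (GL (Fin m) F) V')
  (ψ : AddChar F Circle)

/-- `C(a) · R` is a Laurent polynomial when `R` is. [folklore] -/
theorem IsLaurent.C_mul {R : RatFunc ℂ} (h : IsLaurent R) (a : ℂ) : IsLaurent (RatFunc.C a * R) := by
  obtain ⟨Q, k, rfl⟩ := h
  refine ⟨Polynomial.C a * Q, k, ?_⟩
  rw [map_mul, mul_div_assoc, RatFunc.algebraMap_C]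

/-- **`HasRSLFactor` is unchanged when all zeta integrals are multiplied by a non-zero
constant**, in particular when the measure `ν₂` has integrals `c` times those of `ν₁`: every
`Ψ_{ν₂}(s; W, W') = c Ψ_{ν₁}(s; W, W')` is again `(Laurent)/P`, and `P⁻¹ = ∑ (c⁻¹ Q_i) Ψ_{ν₂,i}`.
(JPSS 1983, Thm. 2.7 (ii): the fractional ideal is unchanged.) [folklore] -/
theorem HasRSLFactor.of_integral_eq_mul
    {ν₁ ν₂ : Measure (GL (Fin m) F ⧸ upperUnitriangular (Fin m) F)} {c : ℂ} (hc : c ≠ 0)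
    (h : ∀ f : GL (Fin m) F ⧸ upperUnitriangular (Fin m) F → ℂ, ∫ x, f x ∂ν₂ = c * ∫ x, f x ∂ν₁)
    {P : ℂ[X]} (hP : HasRSLFactor hmn π π' ψ ν₁ P) : HasRSLFactor hmn π π' ψ ν₂ P := by
  have hq : 1 < residueFieldCard F := one_lt_residueFieldCard F
  have hZ : ∀ (W : GL (Fin n) F → ℂ) (W' : GL (Fin m) F → ℂ) (s : ℂ),
      rsZeta hmn ν₂ W W' s = c * rsZeta hmn ν₁ W W' s := fun W W' s => h _
  obtain ⟨h0, ha, k, Λ, Λ', v, v', Q, hΛ, hΛ', hQ, hE⟩ := hP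
  refine ⟨h0, fun L hL L' hL' w w' => ?_, k, Λ, Λ', v, v', fun i => RatFunc.C c⁻¹ * Q i, hΛ, hΛ',
    fun i => (hQ i).C_mul _, ?_⟩
  · -- clause (a): rescale the Laurent numerator
    obtain ⟨R, hR, hRE⟩ := ha L hL L' hL' w w'
    refine ⟨RatFunc.C c * R, hR.C_mul c, ?_⟩
    have hE' : EqOnRightHalfPlane (residueFieldCard F)
        (rsZeta hmn ν₂ (whittakerModel π L w) (whittakerModel π' L' w'))
        (RatFunc.C c * (R * rsLRat P)) := by
      rw [eqOnRightHalfPlane_iff]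
      filter_upwards [eqOnRightHalfPlane_iff.1 hRE,
        eventually_evalAtQ_mul hq (RatFunc.C c) (R * rsLRat P)] with s hs hmul
      rw [hZ, hs, hmul, evalAtQ_C]
    simpa only [mul_assoc] using hE'
  · -- clause (b): rescale the combination
    rw [eqOnRightHalfPlane_iff] at hE ⊢
    have hCQ : ∀ᶠ s in rightHalfPlanes, ∀ i, evalAtQ (residueFieldCard F) (RatFunc.C c⁻¹ * Q i) s =
        c⁻¹ * evalAtQ (residueFieldCard F) (Q i) s := by
      refine Filter.eventually_all.2 fun i => ?_
      filter_upwards [eventually_evalAtQ_mul hq (RatFunc.C c⁻¹) (Q i)] with s hs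
      rw [hs, evalAtQ_C]
    filter_upwards [hE, hCQ] with s hs hCs
    rw [← hs]
    refine Finset.sum_congr rfl fun i _ => ?_
    rw [hCs i, hZ]
    field_simp

end Rescale

/-! ### Part 3: measure independence for `GL_n × GL₁` and the pole bound for every `ν` -/

section Independence

variable {F : Type*} [Field F] [ValuativeRel F] [TopologicalSpace F] [IsNonarchimedeanLocalField F]
  [MeasurableSpace F] [BorelSpace F]
  [MeasurableSpace (GL (Fin 1) F ⧸ upperUnitriangular (Fin 1) F)]
  [BorelSpace (GL (Fin 1) F ⧸ upperUnitriangular (Fin 1) F)]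
  {n : ℕ} {V : Type*} [AddCommGroup V] [Module ℂ V] {V' : Type*} [AddCommGroup V'] [Module ℂ V']

/-- **The `GL_n × GL₁` Rankin–Selberg `L`-factor does not depend on the choice of the invariant
measure**: for two `GL₁(F)`-invariant Borel measures `ν₁`, `ν₂` on `GL₁(F) ⧸ U₁`, finite on
compacts and positive on opens, `HasRSLFactor hn π π' ψ ν₁ P ↔ HasRSLFactor hn π π' ψ ν₂ P`.
(JPSS 1983, Thm. 2.7 (ii); Cogdell 2004, Thm. 6.2.) [cite: JacquetPiatetskiShapiroShalika1983, Thm. 2.7 (ii)] -/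
theorem hasRSLFactor_iff_of_smulInvariant (hn : 1 < n) (π : Representation ℂ (GL (Fin n) F) V)
    (π' : Representation ℂ (GL (Fin 1) F) V') (ψ : AddChar F Circle)
    (ν₁ ν₂ : Measure (GL (Fin 1) F ⧸ upperUnitriangular (Fin 1) F))
    [SMulInvariantMeasure (GL (Fin 1) F) (GL (Fin 1) F ⧸ upperUnitriangular (Fin 1) F) ν₁]
    [IsFiniteMeasureOnCompacts ν₁] [ν₁.IsOpenPosMeasure]
    [SMulInvariantMeasure (GL (Fin 1) F) (GL (Fin 1) F ⧸ upperUnitriangular (Fin 1) F) ν₂]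
    [IsFiniteMeasureOnCompacts ν₂] [ν₂.IsOpenPosMeasure] (P : ℂ[X]) :
    HasRSLFactor hn π π' ψ ν₁ P ↔ HasRSLFactor hn π π' ψ ν₂ P := by
  constructor
  · intro h
    obtain ⟨c, hc, hcf⟩ := exists_pos_integral_eq_mul ν₁ ν₂
    exact HasRSLFactor.of_integral_eq_mul hn π π' ψ (c := (c : ℂ)) (by exact_mod_cast hc.ne') hcf h
  · intro h
    obtain ⟨c, hc, hcf⟩ := exists_pos_integral_eq_mul ν₂ ν₁
    exact HasRSLFactor.of_integral_eq_mul hn π π' ψ (c := (c : ℂ)) (by exact_mod_cast hc.ne') hcf h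

/-- **The pole bound for every invariant measure** (Jacquet–Langlands 1970, Prop. 3.5 with
Props. 2.9–2.10, in the form `natDegree_le_finrank_of_hasRSLFactor` of `WhittakerTorusJacquetGL2`,
freed from its particular measure by `hasRSLFactor_iff_of_smulInvariant`): for `π` smooth on
`GL₂(F)` with finite-dimensional Jacquet module, `ψ` continuous non-trivial, `H = d(𝒪ˣ, 1)` and
ANY `GL₁(F)`-invariant Radon full-support `ν` on `GL₁(F) ⧸ U₁`, every `P` with
`HasRSLFactor (1<2) π 1 ψ ν P` has `deg P ≤ dim (image of V^H in V_N)`.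
[cite: JacquetLanglands1970, Prop. 2.10, Prop. 3.5] -/
theorem natDegree_le_finrank_of_hasRSLFactor' (π : Representation ℂ (GL (Fin 2) F) V)
    (hπ : π.IsSmooth) {ψ : AddChar F Circle} (hψ : ψ.IsContinuousNontrivial)
    [FiniteDimensional ℂ (Representation.restrictUnipotentGL F (id : Fin 2 → Fin 2) π).Coinvariants]
    (H : Subgroup (GL (Fin 2) F))
    (hH : ∀ g : GL (Fin 2) F, g ∈ H ↔ ∃ u : Fˣ, valuation F (u : F) = 1 ∧ g = diagGL2 u 1)
    (ν : Measure (GL (Fin 1) F ⧸ upperUnitriangular (Fin 1) F))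
    [SMulInvariantMeasure (GL (Fin 1) F) (GL (Fin 1) F ⧸ upperUnitriangular (Fin 1) F) ν]
    [IsFiniteMeasureOnCompacts ν] [ν.IsOpenPosMeasure]
    {P : ℂ[X]} (hP : HasRSLFactor Nat.one_lt_two π (Representation.trivial ℂ (GL (Fin 1) F) ℂ) ψ ν P) :
    P.natDegree ≤ Module.finrank ℂ
      (Submodule.map (Representation.Coinvariants.mk
        (Representation.restrictUnipotentGL F (id : Fin 2 → Fin 2) π)) (π.fixedPoints H)) := by
  obtain ⟨ν₀, hinv, hfin, hpos, hC⟩ := natDegree_le_finrank_of_hasRSLFactor π hπ hψ H hH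
  haveI := hinv; haveI := hfin; haveI := hpos
  exact hC P ((hasRSLFactor_iff_of_smulInvariant Nat.one_lt_two π _ ψ ν ν₀ P).1 hP)

end Independence

end Literature.NumberTheory.Automorphic

end
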